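import Literature.AnabelianGeometry.EtaleTheta.CyclotomicEnvelope
import Mathlib.GroupTheory.Commutator.Basic
import Mathlib.GroupTheory.SpecificGroups.Cyclic

/-!
# Cyclotomic envelopes: lemmas for the discharge of [EtTh] §2
# (Prop 2.12 (ii), Prop 2.14 (ii), Cor 2.18 (ii), (iv))

Mochizuki, *The Étale Theta Function and its Frobenioid-theoretic Manifestations* [EtTh],
Publ. RIMS 45 (2009), §2, PRIMS text pp.44–63 (locators `p.N` = PDF pages of the PRIMS text;
bib key `MochizukiEtTh2009`).

Pure group theory over the cyclotomic envelope `CycEnvelope aug χ = μ ⋊[χ ∘ aug] Π` of Def 2.10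
(file `CyclotomicEnvelope.lean`), PROVED here once so that the discharge files
`Discharge/Sec2*.lean` over the interfaces `ThetaEnvData` / `RigidData` stay short:

* `map_algSection_sup_ker_proj`, `map_algSection_inf_comap`: images of subgroups under the
  tautological section `s^alg` versus inverse images under `Π[μ_N] ↠ Π` — the mechanism of
  "Assertion (ii) follows formally from assertion (i)" in the proof of Prop 2.12 (p.46);
* `commutator_deltaEnv`: `[Δ[μ_N], Δ[μ_N]] = s^alg([Δ, Δ])`, from "`Δ[μ_N] = Δ × Δ_{μ_N}`"
  (Def 2.10, p.44);
* the algebra of the cocycle shifts `α_δ` of Prop 2.14 (ii) (p.49): products, inverses, congruence,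
  pull-back of cocycles along homomorphisms compatible with the augmentations (inflation);
* `twist`: the automorphism `x ↦ φ(x̄) · x` of `Π[μ_N]` attached to a homomorphism `φ : Π → μ_N`
  with `χ`-invariant values — the automorphisms "`Hom(Π•_Y/Π•_Ÿ, Ker(Π• ↠ Π•_Y))`" of the proof of
  Cor 2.18 (iv) (p.63) — and its commutation with shifts and with `μ_N`-conjugation;
* `mulEquiv_apply_eq_self_of_mul_self_eq_one`: an automorphism of a cyclic group fixes its
  elements killed by `2` (why `χ`-invariance holds for `φ` of order `2`);
* `image_muConjClass_eq`: an automorphism fixing `μ_N` pointwise carries `μ_N`-conjugacy classes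
  of subgroups (Def 2.10, p.44) to `μ_N`-conjugacy classes.

Nothing here refers to curves; no named facts are introduced (every declaration is proved).
-/

namespace Literature.AnabelianGeometry.EtaleTheta

open scoped commutatorElement

/-! ## Automorphisms of cyclic groups fix the `2`-torsion -/

/-- An automorphism `σ` of a cyclic group fixes every element `x` with `x² = 1`: writing
`σ = (· ^ m)` (`MonoidHom.map_cyclic`), `m` even would give `σ x = 1`, i.e. `x = 1`, and `m` odd
gives `σ x = x`. Used for the `G_K`-invariance of `2`-torsion values in `μ_N` (Cor 2.18 (iv):
the group `Hom(Π•_Y/Π•_Ÿ, μ_N)`, `[Π•_Y : Π•_Ÿ] = 2`). [cite: MochizukiEtTh2009, Cor 2.18(iv) p.63] -/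
theorem mulEquiv_apply_eq_self_of_mul_self_eq_one {C : Type*} [Group C] [IsCyclic C] (σ : C ≃* C)
    {x : C} (hx : x * x = 1) : σ x = x := by
  obtain ⟨m, hm⟩ := MonoidHom.map_cyclic σ.toMonoidHom
  have hσ : σ x = x ^ m := hm x
  have hx2 : x ^ (2 : ℤ) = 1 := by rw [zpow_two]; exact hx
  obtain ⟨k, hk | hk⟩ := Int.even_or_odd' m
  · have h1 : σ x = 1 := by rw [hσ, hk, zpow_mul, hx2, one_zpow]
    have hx1 : x = 1 := σ.injective (h1.trans (map_one σ).symm)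
    rw [hx1, map_one]
  · rw [hσ, hk, zpow_add, zpow_mul, hx2, one_zpow, one_mul, zpow_one]

namespace CycEnvelope

/-! ## Subgroups of the envelope: `s^alg`-images versus inverse images -/

section Subgroups

variable {P G μ : Type*} [Group P] [Group G] [CommGroup μ] (aug : P →* G) (χ : G →* MulAut μ)

/-- Every element of `Π[μ_N]` is `(μ_N-part) · s^alg(image in Π)`: `⟨a, g⟩ = ι(a) · s^alg(g)`.
[cite: MochizukiEtTh2009, Def 2.10 p.44] -/
theorem inMu_mul_algSection (x : CycEnvelope aug χ) :
    inMu aug χ x.left * algSection aug χ x.right = x := by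
  ext <;> simp

/-- The tautological section is injective. [cite: MochizukiEtTh2009, Def 2.10 p.44] -/
theorem algSection_injective : Function.Injective (algSection aug χ) :=
  SemidirectProduct.inr_injective

/-- `s^alg(H) · μ_N = (Π[μ_N] ↠ Π)⁻¹(H)`: the subgroup generated by the image of `H ⊆ Π` under the
tautological section and the cyclotome is the full inverse image of `H` ("`H[μ_N]`").
[cite: MochizukiEtTh2009, Def 2.10 p.44] -/
theorem map_algSection_sup_ker_proj (H : Subgroup P) :
    H.map (algSection aug χ) ⊔ (proj aug χ).ker = H.comap (proj aug χ) := by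
  refine le_antisymm (sup_le ?_ ?_) fun x hx => ?_
  · rintro _ ⟨h, hh, rfl⟩
    simpa [Subgroup.mem_comap] using hh
  · intro x hx
    rw [MonoidHom.mem_ker] at hx
    simp [Subgroup.mem_comap, hx]
  · rw [Subgroup.mem_comap] at hx
    rw [← inMu_mul_algSection aug χ x]
    refine Subgroup.mul_mem _ (Subgroup.mem_sup_right ?_)
      (Subgroup.mem_sup_left ⟨x.right, hx, rfl⟩)
    rw [MonoidHom.mem_ker]
    simp

/-- `s^alg(H) ∩ (Π[μ_N] ↠ Π)⁻¹(K) = s^alg(H ∩ K)`. [cite: MochizukiEtTh2009, Def 2.10 p.44] -/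
theorem map_algSection_inf_comap (H K : Subgroup P) :
    H.map (algSection aug χ) ⊓ K.comap (proj aug χ) = (H ⊓ K).map (algSection aug χ) := by
  ext x
  constructor
  · intro hx
    obtain ⟨h, hh, rfl⟩ := (Subgroup.mem_inf.mp hx).1
    have hK : proj aug χ (algSection aug χ h) ∈ K := Subgroup.mem_comap.mp (Subgroup.mem_inf.mp hx).2
    have hK' : h ∈ K := by simpa using hK
    exact ⟨h, ⟨hh, hK'⟩, rfl⟩
  · rintro ⟨h, ⟨hh, hk⟩, rfl⟩
    exact Subgroup.mem_inf.mpr ⟨⟨h, hh, rfl⟩, Subgroup.mem_comap.mpr (by simpa using hk)⟩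

/-- `s^alg(A) ∩ (s^alg(B) · μ_N) = s^alg(A ∩ B)` — the lattice identity behind "Assertion (ii)
follows formally from assertion (i)" (proof of Prop 2.12, p.46).
[cite: MochizukiEtTh2009, Prop 2.12(ii) p.45] -/
theorem map_algSection_inf_map_sup_ker (A B : Subgroup P) :
    A.map (algSection aug χ) ⊓ (B.map (algSection aug χ) ⊔ (proj aug χ).ker) =
      (A ⊓ B).map (algSection aug χ) := by
  rw [map_algSection_sup_ker_proj, map_algSection_inf_comap]

/-- `Δ[μ_N] = s^alg(Δ) · μ_N` (Def 2.10: "`Δ[μ_N] = Δ × Δ_{μ_N}`", subgroup form).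
[cite: MochizukiEtTh2009, Def 2.10 p.44] -/
theorem deltaEnv_eq_map_sup_ker :
    deltaEnv aug χ = (aug.ker).map (algSection aug χ) ⊔ (proj aug χ).ker := by
  rw [map_algSection_sup_ker_proj, MonoidHom.comap_ker]

/-- The commutator of two elements of `Δ[μ_N]` is the tautological lift of the commutator of their
images in `Δ` (the cyclotome is central in `Δ[μ_N] = Δ × Δ_{μ_N}`).
[cite: MochizukiEtTh2009, Def 2.10 p.44] -/
theorem commutatorElement_eq_of_mem_deltaEnv {x y : CycEnvelope aug χ} (hx : x ∈ deltaEnv aug χ)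
    (hy : y ∈ deltaEnv aug χ) : ⁅x, y⁆ = algSection aug χ ⁅x.right, y.right⁆ := by
  rw [mem_deltaEnv_iff, MonoidHom.mem_ker] at hx hy
  rw [commutatorElement_def x y]
  ext
  · simp only [SemidirectProduct.mul_left, SemidirectProduct.mul_right, SemidirectProduct.inv_left,
      SemidirectProduct.inv_right, MonoidHom.coe_comp, Function.comp_apply, map_mul, map_inv, hx,
      hy, map_one, inv_one, mul_one, MulAut.one_apply, SemidirectProduct.left_inr]
    rw [mul_inv_cancel_comm, mul_inv_cancel]
  · simp [commutatorElement_def]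

/-- **`[Δ[μ_N], Δ[μ_N]] = s^alg([Δ, Δ])`** as subgroups of `Π[μ_N]` ("`Δ[μ_N] = Δ × Δ_{μ_N}`", so
commutators live in the `Δ`-factor). [cite: MochizukiEtTh2009, Prop 2.12(ii) p.45] -/
theorem commutator_deltaEnv :
    ⁅deltaEnv aug χ, deltaEnv aug χ⁆ = (⁅aug.ker, aug.ker⁆).map (algSection aug χ) := by
  refine le_antisymm ?_ ?_
  · rw [Subgroup.commutator_le]
    intro x hx y hy
    rw [commutatorElement_eq_of_mem_deltaEnv aug χ hx hy]
    exact ⟨⁅x.right, y.right⁆, Subgroup.commutator_mem_commutator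
      ((mem_deltaEnv_iff aug χ x).mp hx) ((mem_deltaEnv_iff aug χ y).mp hy), rfl⟩
  · rw [Subgroup.map_commutator]
    have h : (aug.ker).map (algSection aug χ) ≤ deltaEnv aug χ := by
      rintro _ ⟨g, hg, rfl⟩
      rw [mem_deltaEnv_iff]
      simpa using hg
    exact Subgroup.commutator_mono h h

/-- An automorphism of `Π[μ_N]` fixing the cyclotome `μ_N` pointwise carries the `μ_N`-conjugacy
class of a subgroup `H` onto the `μ_N`-conjugacy class of the image of `H`.
[cite: MochizukiEtTh2009, Def 2.10 p.44] -/
theorem image_muConjClass_eq (α : MulAut (CycEnvelope aug χ))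
    (hα : ∀ a : μ, α (inMu aug χ a) = inMu aug χ a) (H : Subgroup (CycEnvelope aug χ)) :
    (fun K : Subgroup (CycEnvelope aug χ) => K.map α.toMonoidHom) '' muConjClass aug χ H =
      muConjClass aug χ (H.map α.toMonoidHom) := by
  have key : ∀ a : μ, (α.toMonoidHom).comp (MulAut.conj (inMu aug χ a)).toMonoidHom =
      (MulAut.conj (inMu aug χ a)).toMonoidHom.comp α.toMonoidHom := by
    intro a
    refine MonoidHom.ext fun x => ?_
    simp only [MonoidHom.coe_comp, Function.comp_apply, MulEquiv.coe_toMonoidHom, MulAut.conj_apply,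
      map_mul, map_inv, hα]
  ext K
  constructor
  · rintro ⟨_, ⟨a, rfl⟩, rfl⟩
    refine ⟨a, ?_⟩
    change (H.map _).map _ = (H.map _).map _
    rw [Subgroup.map_map, Subgroup.map_map, key]
  · rintro ⟨a, rfl⟩
    refine ⟨H.map (MulAut.conj (inMu aug χ a)).toMonoidHom, ⟨a, rfl⟩, ?_⟩
    change (H.map _).map _ = (H.map _).map _
    rw [Subgroup.map_map, Subgroup.map_map, key]

end Subgroups

/-! ## The algebra of cocycles and shifts (Prop 2.14 (ii)) -/

section Cocycles

variable {P G μ : Type*} [Group P] [Group G] [CommGroup μ] {aug : P →* G} {χ : G →* MulAut μ}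

/-- A cocycle vanishes at `1`. [cite: MochizukiEtTh2009, Prop 2.14(ii) p.49] -/
theorem IsEnvCocycle.apply_one {δ : P → μ} (hδ : IsEnvCocycle aug χ δ) : δ 1 = 1 := by
  have h := hδ 1 1
  simp only [mul_one, _root_.map_one, MulAut.one_apply] at h
  exact mul_eq_left.mp h.symm

variable (aug χ) in
/-- The trivial cocycle. [cite: MochizukiEtTh2009, Prop 2.14(ii) p.49] -/
theorem isEnvCocycle_one : IsEnvCocycle aug χ (1 : P → μ) := fun g h => by simp

/-- The product of two cocycles is a cocycle (`μ_N` is abelian).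
[cite: MochizukiEtTh2009, Prop 2.14(ii) p.49] -/
theorem IsEnvCocycle.mul {δ δ' : P → μ} (hδ : IsEnvCocycle aug χ δ) (hδ' : IsEnvCocycle aug χ δ') :
    IsEnvCocycle aug χ (δ * δ') := fun g h => by
  simp only [Pi.mul_apply, hδ g h, hδ' g h, map_mul]
  exact mul_mul_mul_comm _ _ _ _

/-- The inverse of a cocycle is a cocycle. [cite: MochizukiEtTh2009, Prop 2.14(ii) p.49] -/
theorem IsEnvCocycle.inv {δ : P → μ} (hδ : IsEnvCocycle aug χ δ) : IsEnvCocycle aug χ δ⁻¹ :=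
  fun g h => by
  simp only [Pi.inv_apply, hδ g h, mul_inv, map_inv]

/-- Pull-back of a cocycle along a homomorphism `f : Q → Π` is a cocycle for the augmentation
`aug ∘ f` (restriction to a subgroup; INFLATION from `G_K` when `Π = G_K`, `aug = id`).
[cite: MochizukiEtTh2009, Def 2.13(i) p.47] -/
theorem IsEnvCocycle.comp {Q : Type*} [Group Q] (f : Q →* P) {δ : P → μ}
    (hδ : IsEnvCocycle aug χ δ) : IsEnvCocycle (aug.comp f) χ (δ ∘ f) := fun g h => by
  simp only [Function.comp_apply, map_mul, MonoidHom.coe_comp]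
  exact hδ (f g) (f h)

/-- The shift in coordinates. [cite: MochizukiEtTh2009, Prop 2.14(ii) p.49] -/
@[simp] theorem shift_apply {δ : P → μ} (hδ : IsEnvCocycle aug χ δ) (x : CycEnvelope aug χ) :
    shift hδ x = ⟨x.left * δ x.right, x.right⟩ := rfl

/-- The inverse shift in coordinates. [cite: MochizukiEtTh2009, Prop 2.14(ii) p.49] -/
@[simp] theorem shift_symm_apply {δ : P → μ} (hδ : IsEnvCocycle aug χ δ) (x : CycEnvelope aug χ) :
    (shift hδ).symm x = ⟨x.left * (δ x.right)⁻¹, x.right⟩ := rfl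

/-- The shift depends only on the cocycle, not on the proof.
[cite: MochizukiEtTh2009, Prop 2.14(ii) p.49] -/
theorem shift_congr {δ δ' : P → μ} (hδ : IsEnvCocycle aug χ δ) (hδ' : IsEnvCocycle aug χ δ')
    (h : δ = δ') : shift hδ = shift hδ' := by
  subst h
  rfl

variable (aug χ) in
/-- The shift by the trivial cocycle is the identity. [cite: MochizukiEtTh2009, Prop 2.14(ii) p.49] -/
theorem shift_one : shift (isEnvCocycle_one aug χ) = 1 := by
  ext x <;> simp

/-- Shifts compose by multiplying cocycles: `α_{δδ'} = α_δ ∘ α_{δ'}`.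
[cite: MochizukiEtTh2009, Prop 2.14(ii) p.49] -/
theorem shift_mul {δ δ' : P → μ} (hδ : IsEnvCocycle aug χ δ) (hδ' : IsEnvCocycle aug χ δ') :
    shift (hδ.mul hδ') = shift hδ * shift hδ' := by
  ext x
  · simp only [shift_apply, Pi.mul_apply, MulAut.mul_apply]
    rw [mul_assoc, mul_comm (δ x.right)]
  · simp

/-- The inverse of a shift is the shift by the inverse cocycle.
[cite: MochizukiEtTh2009, Prop 2.14(ii) p.49] -/
theorem shift_inv {δ : P → μ} (hδ : IsEnvCocycle aug χ δ) : (shift hδ)⁻¹ = shift hδ.inv := by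
  ext x
  · simp [MulAut.inv_apply]
  · simp [MulAut.inv_apply]

/-- Shifts commute with each other. [cite: MochizukiEtTh2009, Prop 2.14(ii) p.49] -/
theorem shift_comm {δ δ' : P → μ} (hδ : IsEnvCocycle aug χ δ) (hδ' : IsEnvCocycle aug χ δ') :
    shift hδ * shift hδ' = shift hδ' * shift hδ := by
  rw [← shift_mul, ← shift_mul]
  exact shift_congr _ _ (mul_comm _ _)

/-- A shift moves the tautological section by the cocycle: `α_δ(s^alg(g)) = ι(δ g) · s^alg(g)`.
[cite: MochizukiEtTh2009, Prop 2.14(ii) p.49] -/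
theorem shift_algSection {δ : P → μ} (hδ : IsEnvCocycle aug χ δ) (g : P) :
    shift hδ (algSection aug χ g) = inMu aug χ (δ g) * algSection aug χ g := by
  ext <;> simp

end Cocycles

/-! ## Twists by `χ`-invariant homomorphisms (Cor 2.18 (iv)) -/

section Twist

variable {P G μ : Type*} [Group P] [Group G] [CommGroup μ] (aug : P →* G) (χ : G →* MulAut μ)

/-- The **twist** of `Π[μ_N]` by a homomorphism `φ : Π → μ_N` whose values are fixed by the action
`χ ∘ aug`: `x ↦ φ(x̄) · x`, in coordinates `⟨a, g⟩ ↦ ⟨φ(g) · a, g⟩` — the automorphisms by which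
"`Hom(Π•_Y/Π•_Ÿ, Ker(Π• ↠ Π•_Y))`" acts in the proof of Cor 2.18 (iv).
[cite: MochizukiEtTh2009, Cor 2.18(iv) p.63] -/
def twist (φ : P →* μ) (hφ : ∀ g h : P, χ (aug g) (φ h) = φ h) : MulAut (CycEnvelope aug χ) where
  toFun x := ⟨φ x.right * x.left, x.right⟩
  invFun x := ⟨(φ x.right)⁻¹ * x.left, x.right⟩
  left_inv x := by ext <;> simp
  right_inv x := by ext <;> simp
  map_mul' x y := by
    ext
    · simp only [SemidirectProduct.mul_left, SemidirectProduct.mul_right, map_mul,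
        MonoidHom.coe_comp, Function.comp_apply, hφ]
      rw [mul_mul_mul_comm]
    · simp

variable {aug χ}

/-- The twist in coordinates. [cite: MochizukiEtTh2009, Cor 2.18(iv) p.63] -/
@[simp] theorem twist_apply (φ : P →* μ) (hφ : ∀ g h : P, χ (aug g) (φ h) = φ h)
    (x : CycEnvelope aug χ) : twist aug χ φ hφ x = ⟨φ x.right * x.left, x.right⟩ := rfl

/-- The inverse twist in coordinates. [cite: MochizukiEtTh2009, Cor 2.18(iv) p.63] -/
@[simp] theorem twist_symm_apply (φ : P →* μ) (hφ : ∀ g h : P, χ (aug g) (φ h) = φ h)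
    (x : CycEnvelope aug χ) : (twist aug χ φ hφ).symm x = ⟨(φ x.right)⁻¹ * x.left, x.right⟩ := rfl

/-- The twist is `x ↦ ι(φ(x̄)) · x`. [cite: MochizukiEtTh2009, Cor 2.18(iv) p.63] -/
theorem twist_eq_inMu_mul (φ : P →* μ) (hφ : ∀ g h : P, χ (aug g) (φ h) = φ h)
    (x : CycEnvelope aug χ) : twist aug χ φ hφ x = inMu aug χ (φ (proj aug χ x)) * x := by
  ext <;> simp

/-- The twist induces the identity on `Π[μ_N] ↠ Π`. [cite: MochizukiEtTh2009, Cor 2.18(iv) p.63] -/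
theorem proj_twist (φ : P →* μ) (hφ : ∀ g h : P, χ (aug g) (φ h) = φ h) (x : CycEnvelope aug χ) :
    proj aug χ (twist aug χ φ hφ x) = proj aug χ x := rfl

/-- The twist fixes the cyclotome pointwise. [cite: MochizukiEtTh2009, Cor 2.18(iv) p.63] -/
theorem twist_inMu (φ : P →* μ) (hφ : ∀ g h : P, χ (aug g) (φ h) = φ h) (a : μ) :
    twist aug χ φ hφ (inMu aug χ a) = inMu aug χ a := by
  ext <;> simp

/-- The twist fixes `s^alg(g)` whenever `φ g = 1`. [cite: MochizukiEtTh2009, Cor 2.18(iv) p.63] -/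
theorem twist_algSection_of_eq_one (φ : P →* μ) (hφ : ∀ g h : P, χ (aug g) (φ h) = φ h)
    {g : P} (hg : φ g = 1) : twist aug χ φ hφ (algSection aug χ g) = algSection aug χ g := by
  ext <;> simp [hg]

/-- More generally the twist fixes every `x` with `φ(x̄) = 1`.
[cite: MochizukiEtTh2009, Cor 2.18(iv) p.63] -/
theorem twist_apply_of_eq_one (φ : P →* μ) (hφ : ∀ g h : P, χ (aug g) (φ h) = φ h)
    {x : CycEnvelope aug χ} (hx : φ x.right = 1) : twist aug χ φ hφ x = x := by
  ext <;> simp [hx]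

/-- Twists commute with cocycle shifts. [cite: MochizukiEtTh2009, Cor 2.18(iv) p.63] -/
theorem twist_shift_comm (φ : P →* μ) (hφ : ∀ g h : P, χ (aug g) (φ h) = φ h) {δ : P → μ}
    (hδ : IsEnvCocycle aug χ δ) :
    twist aug χ φ hφ * shift hδ = shift hδ * twist aug χ φ hφ := by
  ext x
  · simp only [MulAut.mul_apply, twist_apply, shift_apply]
    rw [mul_assoc]
  · simp

/-- Twists commute with conjugation by the cyclotome (which they fix).
[cite: MochizukiEtTh2009, Cor 2.18(iv) p.63] -/
theorem twist_conj_inMu_comm (φ : P →* μ) (hφ : ∀ g h : P, χ (aug g) (φ h) = φ h) (c : μ) :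
    twist aug χ φ hφ * MulAut.conj (inMu aug χ c) = MulAut.conj (inMu aug χ c) * twist aug χ φ hφ := by
  ext x
  · simp only [MulAut.mul_apply, MulAut.conj_apply, map_mul, map_inv, twist_inMu]
  · simp only [MulAut.mul_apply, MulAut.conj_apply, map_mul, map_inv, twist_inMu]

end Twist

end CycEnvelope

end Literature.AnabelianGeometry.EtaleTheta
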